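import Summits.CriticalPhenomena.PercolationContinuityZ3.Theorems.PercNearOneGluingNoHeavyLowerTailSahiThreeCopyBlocks

/-!
# `NoHeavyLowerTail` (crux stmt-CriticalPhenomena-4575), Sahi programme: **THE TWO-POINT REDUCTION THEOREM** — a finite certificate on the
# front cube `{0,1}^k` (two bilinear inequalities (N1), (N2) between level-functions) gives 3C-SAHI `c_{(π,b)}(F,G,H) ≥ 0` for a free slot
# `F = f(front k coordinates)` against two ARBITRARY nonnegative monotone slots `G, H`, for EVERY back profile `b` in EVERY dimension

Support file (Sahi cell, seat `prim-sahi-p1`, generation 59; `--supports stmt-CriticalPhenomena-4575`); companions `…SahiThreeCopy` (gen 53: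
`N3`, `tc`, `sec`, `N3_cons`, three-copy Harris `N3_le_N3_mul`), `…SahiThreeCopyBlocks` (gen 54: `appendProf`).  Pure bookkeeping + one use of
three-copy Harris; no `sorry`, standard axioms; nothing conjectural is used or asserted.

THE POINT (memo FROM-prim-sahi-p1-gen59, "sandwich"; gen58 §9 "two-point reduction").  Fix `k` FRONT ("named") coordinates with profile
`π`, and a free slot `F = frontFn k f` depending only on them (`f : {0,1}^k → ℝ`, e.g. the indicator of an up-set of levels).  Peeling the front
coordinates (`N3_appendProf`, the `k`-fold form of the slice recursion `N3_cons`; front sections `secF k e G = G(e,·)`) turns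
`c_{(π,b)}(F,G,H)` into the TOKEN FORM (`tc_frontFn_eq`)
`Σ_{(e₁,e₂,e₃) arrangement of π} [2f(e₁)N_b(G_{e₁}H_{e₁};1;1) − f(e₁)N_b(G_{e₂}H_{e₂};1;1) − f(e₂)N_b(G_{e₁};H_{e₂};1) − f(e₂)N_b(H_{e₁};G_{e₂};1)
 + f(e₁)N_b(1;G_{e₂};H_{e₃})]`.
Given per-arrangement weights `θ ≥ 0`, three-copy Harris on the BACK cube converts `θ·N_b(G_{e₁}H_{e₁};1;1) ≥ θ·N_b(G_{e₁};H_{e₁};1)`, after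
which everything is a sum over back arrangements `(x,y,z)` of the TWO-POINT KERNEL `K(x,y) = N1(G_·(x),H_·(x)) + N2(G_·(x),H_·(y))` (`tpKernel`),
where for level-functions `φ, ψ : {0,1}^k → ℝ`
`N1(φ,ψ) = Σ_arr [(2f(e₁)−θ)φ(e₁)ψ(e₁) − f(e₁)φ(e₂)ψ(e₂)]`,  `N2(φ,ψ) = Σ_arr [θφ(e₁)ψ(e₁) + f(e₁)φ(e₂)ψ(e₃) − f(e₂)φ(e₁)ψ(e₂) − f(e₂)φ(e₂)ψ(e₁)]`.
★★ `tc_frontFn_nonneg_of_twoPoint`: if (N1) and (N2) are `≥ 0` for ALL pairs of nonnegative monotone level-functions, then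
`0 ≤ c_{(π,b)}(frontFn f, G, H)` for every back profile `b` on a cube of ANY dimension and all nonnegative monotone `G, H` — the front
structure carries all the three-copy combinatorics, the back cube is handled by one Harris inequality per front level and a pointwise check.
By bilinearity and the finite layer cake, (N1)/(N2) need only be checked on indicators of up-sets `V, W ⊆ {0,1}^k`, where they read
`0 ≤ s(V∩W)` and `s(V∩W) ≤ c_π(1_f,1_V,1_W)` for the additive set function `s_e = 2·mult(e)f(e) − n_e − conv_e` (memo gen59 §2, the SANDWICH;
`conv_e = Σ_{e₂,e₃} θ(e,e₂,e₃)`): a finite certificate per `(f, π)`, found by a small LP and non-empty for every up-set `f` on `k ≤ 4`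
coordinates and every profile (memo gen59 §3; exact, kit j337043). [this work]
-/

namespace Summit.CriticalPhenomena.PercolationContinuityZ3.Theorems.SahiThreeCopy

open Finset Function Literature.Combinatorics.Sahi2008
open scoped BigOperators

noncomputable section

variable {d : ℕ}

/-! ### §1 Front sections and the `k`-fold slice recursion -/

/-- The FRONT SECTION of `G : {0,1}^{d+k} → ℝ` at the front levels `e ∈ {0,1}^k`: `(secF k e G)(y) = G(e, y)` (peeling front coordinates). [this work] -/
def secF : (k : ℕ) → Pt k → (Pt (d + k) → ℝ) → (Pt d → ℝ)
  | 0, _, G => G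
  | k + 1, e, G => secF k (Fin.tail e) (sec G (e 0))

/-- Peeling one front coordinate. [this work] -/
theorem secF_succ (k : ℕ) (e : Pt (k + 1)) (G : Pt (d + (k + 1)) → ℝ) : secF (k + 1) e G = secF k (Fin.tail e) (sec G (e 0)) := rfl

/-- Peeling one front coordinate, `Fin.cons` form. [this work] -/
theorem secF_cons (k : ℕ) (ε : Bool) (e : Pt k) (G : Pt (d + (k + 1)) → ℝ) :
    secF (k + 1) (Fin.cons ε e) G = secF k e (sec G ε) := by
  rw [secF_succ, Fin.tail_cons, Fin.cons_zero]

/-- Front sections commute with products. [this work] -/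
theorem secF_mul : ∀ (k : ℕ) (e : Pt k) (G H : Pt (d + k) → ℝ), secF k e (G * H) = secF k e G * secF k e H
  | 0, _, _, _ => rfl
  | k + 1, e, G, H => by rw [secF_succ, secF_succ, secF_succ, sec_mul, secF_mul k]

/-- Front sections of `1`. [this work] -/
theorem secF_one : ∀ (k : ℕ) (e : Pt k), secF k e (1 : Pt (d + k) → ℝ) = 1
  | 0, _ => rfl
  | k + 1, e => by rw [secF_succ, sec_one, secF_one k]

/-- Front sections of a nonnegative function are nonnegative. [this work] -/
theorem secF_nonneg : ∀ (k : ℕ) (e : Pt k) {G : Pt (d + k) → ℝ}, (∀ w, 0 ≤ G w) → ∀ y, 0 ≤ secF k e G y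
  | 0, _, _, hG, y => hG y
  | k + 1, e, _, hG, y => secF_nonneg k (Fin.tail e) (sec_nonneg hG (e 0)) y

/-- Front sections of a monotone function are monotone (in the back variables). [this work] -/
theorem secF_monotone : ∀ (k : ℕ) (e : Pt k) {G : Pt (d + k) → ℝ}, Monotone G → Monotone (secF k e G)
  | 0, _, _, hG => hG
  | k + 1, e, _, hG => secF_monotone k (Fin.tail e) (sec_monotone hG (e 0))

/-- Front sections of a monotone function are monotone IN THE LEVEL: `e ≤ e' ⇒ G(e,·) ≤ G(e',·)`. [this work] -/
theorem secF_mono_level : ∀ (k : ℕ) {e e' : Pt k} (_ : e ≤ e') {G : Pt (d + k) → ℝ}, Monotone G → ∀ y, secF k e G y ≤ secF k e' G y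
  | 0, _, _, _, _, _, _ => le_rfl
  | k + 1, e, e', hee', G, hG, y => by
    rw [secF_succ, secF_succ]
    have h1 : secF k (Fin.tail e) (sec G (e 0)) y ≤ secF k (Fin.tail e') (sec G (e 0)) y :=
      secF_mono_level k (fun i => hee' i.succ) (sec_monotone hG (e 0)) y
    have h2 : ∀ z, sec G (e 0) z ≤ sec G (e' 0) z := by
      intro z
      simp only [sec]
      exact hG fun i => by
        refine Fin.cases ?_ (fun j => ?_) i
        · simpa using hee' 0
        · simp
    -- monotonicity of secF in the function argument (pointwise order)
    have h3 : ∀ (k : ℕ) (e : Pt k) {A B : Pt (d + k) → ℝ}, (∀ w, A w ≤ B w) → ∀ y, secF k e A y ≤ secF k e B y := by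
      intro k
      induction k with
      | zero => intro e A B hAB y; exact hAB y
      | succ k ih => intro e A B hAB y; rw [secF_succ, secF_succ]; exact ih (Fin.tail e) (fun w => hAB _) y
    exact h1.trans (h3 k (Fin.tail e') h2 y)

/-- The arrangement condition splits along the front coordinate (profile not syntactically a `Fin.cons`). [this work] -/
theorem ite_isArr_succ {k : ℕ} (π : Fin (k + 1) → ℕ) (ε₁ ε₂ ε₃ : Bool) (x y z : Pt k) (a c : ℝ) :
    (if IsArr π (Fin.cons ε₁ x) (Fin.cons ε₂ y) (Fin.cons ε₃ z) then a else c) =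
      if (ε₁.toNat + ε₂.toNat + ε₃.toNat = π 0 ∧ IsArr (Fin.tail π) x y z) then a else c := by
  have h := ite_isArr_cons (π 0) (Fin.tail π) ε₁ ε₂ ε₃ x y z a c
  rwa [Fin.cons_self_tail] at h

/-- ★ **The `k`-fold slice recursion**: `N_{(π,b)}(F;G;H) = Σ_{(e₁,e₂,e₃) arrangement of π} N_b(F(e₁,·); G(e₂,·); H(e₃,·))`. [this work] -/
theorem N3_appendProf : ∀ (k : ℕ) (π : Fin k → ℕ) (b : Fin d → ℕ) (F G H : Pt (d + k) → ℝ),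
    N3 (appendProf k π b) F G H =
      ∑ e₁ : Pt k, ∑ e₂ : Pt k, ∑ e₃ : Pt k, if IsArr π e₁ e₂ e₃ then N3 b (secF k e₁ F) (secF k e₂ G) (secF k e₃ H) else 0
  | 0, π, b, F, G, H => by
    rw [Fintype.sum_unique, Fintype.sum_unique, Fintype.sum_unique]
    split_ifs with h
    · rfl
    · exact absurd (fun i => Fin.elim0 i) h
  | k + 1, π, b, F, G, H => by
    have hπ : appendProf (k + 1) π b = Fin.cons (π 0) (appendProf k (Fin.tail π) b) := rfl
    rw [hπ, N3_cons]
    simp only [sum_pt_succ (d := k), ite_isArr_succ, secF_cons]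
    rw [sum6_comm]
    refine sum_congr rfl fun ε₁ _ => sum_congr rfl fun ε₂ _ => sum_congr rfl fun ε₃ _ => ?_
    rw [N3_appendProf k (Fin.tail π) b]
    by_cases hc : ε₁.toNat + ε₂.toNat + ε₃.toNat = π 0
    · simp only [hc, true_and, if_true]
    · simp only [hc, false_and, if_false, sum_const_zero]

/-! ### §2 The free slot: a function of the front block -/

/-- A function of the FRONT `k` coordinates only: `frontFn k f (e, y) = f e`. [this work] -/
def frontFn : (k : ℕ) → (Pt k → ℝ) → (Pt (d + k) → ℝ)
  | 0, f => fun _ => f default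
  | k + 1, f => fun w => frontFn k (fun e => f (Fin.cons (w 0) e)) (Fin.tail w)

/-- Sections of a front function: `(frontFn f)(e, ·) = f(e)·1`. [this work] -/
theorem secF_frontFn : ∀ (k : ℕ) (f : Pt k → ℝ) (e : Pt k), secF k e (frontFn (d := d) k f) = f e • (1 : Pt d → ℝ)
  | 0, f, e => by
    funext y; simp only [secF, frontFn, Pi.smul_apply, Pi.one_apply, smul_eq_mul, mul_one]
    congr 1; exact Subsingleton.elim _ _
  | k + 1, f, e => by
    rw [secF_succ]
    have hsec : sec (frontFn (d := d) (k + 1) f) (e 0) = frontFn k (fun e' => f (Fin.cons (e 0) e')) := by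
      funext w; simp only [sec, frontFn, Fin.cons_zero, Fin.tail_cons]
    rw [hsec, secF_frontFn k]
    simp only [Fin.cons_self_tail]

/-- A front function of a nonnegative `f` is nonnegative. [this work] -/
theorem frontFn_nonneg : ∀ (k : ℕ) {f : Pt k → ℝ}, (∀ e, 0 ≤ f e) → ∀ w, 0 ≤ frontFn (d := d) k f w
  | 0, _, hf, _ => hf _
  | k + 1, _, hf, _ => frontFn_nonneg k (fun _ => hf _) _

/-- A front function of a monotone `f` is monotone. [this work] -/
theorem frontFn_monotone : ∀ (k : ℕ) {f : Pt k → ℝ}, Monotone f → Monotone (frontFn (d := d) k f)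
  | 0, _, _ => fun _ _ _ => le_rfl
  | k + 1, f, hf => by
    intro w w' hww'
    simp only [frontFn]
    have h1 : frontFn (d := d) k (fun e => f (Fin.cons (w 0) e)) (Fin.tail w) ≤ frontFn k (fun e => f (Fin.cons (w 0) e)) (Fin.tail w') :=
      frontFn_monotone k (fun e e' hee' => hf (Fin.cons_le_cons.2 ⟨le_rfl, hee'⟩)) (fun i => hww' i.succ)
    have h2 : ∀ (k : ℕ) {g g' : Pt k → ℝ}, (∀ e, g e ≤ g' e) → ∀ v, frontFn (d := d) k g v ≤ frontFn k g' v := by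
      intro k
      induction k with
      | zero => intro g g' hgg' v; exact hgg' _
      | succ k ih => intro g g' hgg' v; exact ih (fun _ => hgg' _) _
    exact h1.trans (h2 k (fun e => hf (Fin.cons_le_cons.2 ⟨hww' 0, le_rfl⟩)) _)

/-! ### §3 The token form of `c_{(π,b)}` for a front free slot -/

/-- ★ **Token form.** For a free slot depending only on the `k` front coordinates, `F = frontFn k f`, and arbitrary `G, H`:
`c_{(π,b)}(F,G,H) = Σ_{(e₁,e₂,e₃) arr π} [ 2f(e₁)·N_b(G_{e₁}H_{e₁};1;1) − f(e₁)·N_b(G_{e₂}H_{e₂};1;1) − f(e₂)·N_b(G_{e₁};H_{e₂};1)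
 − f(e₂)·N_b(H_{e₁};G_{e₂};1) + f(e₁)·N_b(1;G_{e₂};H_{e₃}) ]` (`G_e = secF k e G` the front sections). [this work] -/
theorem tc_frontFn_eq (k : ℕ) (π : Fin k → ℕ) (b : Fin d → ℕ) (f : Pt k → ℝ) (G H : Pt (d + k) → ℝ) :
    tc (appendProf k π b) (frontFn k f) G H =
      ∑ e₁ : Pt k, ∑ e₂ : Pt k, ∑ e₃ : Pt k, if IsArr π e₁ e₂ e₃ then
        (2 * f e₁ * N3 b (secF k e₁ G * secF k e₁ H) 1 1 - f e₁ * N3 b (secF k e₂ G * secF k e₂ H) 1 1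
          - f e₂ * N3 b (secF k e₁ G) (secF k e₂ H) 1 - f e₂ * N3 b (secF k e₁ H) (secF k e₂ G) 1
          + f e₁ * N3 b 1 (secF k e₂ G) (secF k e₃ H)) else 0 := by
  unfold tc
  rw [N3_appendProf, N3_appendProf, N3_appendProf, N3_appendProf, N3_appendProf]
  simp only [secF_mul, secF_one, secF_frontFn, smul_mul_assoc, N3_smul_left, N3_smul_mid, mul_sum,
    ← sum_sub_distrib, ← sum_add_distrib]
  refine sum_congr rfl fun e₁ _ => sum_congr rfl fun e₂ _ => sum_congr rfl fun e₃ _ => ?_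
  split_ifs with h
  · have e1 : N3 b (1 : Pt d → ℝ) (secF k e₂ G * secF k e₂ H) 1 = N3 b (secF k e₂ G * secF k e₂ H) 1 1 := N3_comm12 b _ _ _
    rw [e1]; ring
  · simp

/-! ### §4 The two-point reduction theorem -/

/-- Indicator of an arrangement, as a real number. [this work] -/
def arrInd {n : ℕ} (b : Fin n → ℕ) (x y z : Pt n) : ℝ := if IsArr b x y z then 1 else 0

/-- The arrangement indicator is nonnegative. [this work] -/
theorem arrInd_nonneg {n : ℕ} (b : Fin n → ℕ) (x y z : Pt n) : 0 ≤ arrInd b x y z := by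
  unfold arrInd; split_ifs <;> norm_num

/-- `N_b` as a sum over triples weighted by the arrangement indicator. [this work] -/
theorem N3_eq_sum_triple (b : Fin d → ℕ) (f g h : Pt d → ℝ) :
    N3 b f g h = ∑ τ : Pt d × Pt d × Pt d, arrInd b τ.1 τ.2.1 τ.2.2 * (f τ.1 * g τ.2.1 * h τ.2.2) := by
  unfold N3 arrInd
  rw [Fintype.sum_prod_type]
  refine sum_congr rfl fun x _ => ?_
  rw [Fintype.sum_prod_type]
  refine sum_congr rfl fun y _ => sum_congr rfl fun z _ => ?_
  split_ifs <;> simp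

/-- A triple `if`-sum over `Pt k` as a sum over triples. [this work] -/
theorem sum3_ite_eq_sum_triple {k : ℕ} (π : Fin k → ℕ) (T : Pt k → Pt k → Pt k → ℝ) :
    (∑ e₁ : Pt k, ∑ e₂ : Pt k, ∑ e₃ : Pt k, if IsArr π e₁ e₂ e₃ then T e₁ e₂ e₃ else 0) =
      ∑ σ : Pt k × Pt k × Pt k, arrInd π σ.1 σ.2.1 σ.2.2 * T σ.1 σ.2.1 σ.2.2 := by
  unfold arrInd
  rw [Fintype.sum_prod_type]
  refine sum_congr rfl fun x _ => ?_
  rw [Fintype.sum_prod_type]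
  refine sum_congr rfl fun y _ => sum_congr rfl fun z _ => ?_
  split_ifs <;> simp

/-- The TWO-POINT KERNEL of the certificate `θ` at two back points `x, y` (front-level data `G_e(x)`, `H_e(·)`):
`K(x,y) = Σ_{arr π} [(2f(e₁)−θ)G_{e₁}(x)H_{e₁}(x) − f(e₁)G_{e₂}(x)H_{e₂}(x) + θ·G_{e₁}(x)H_{e₁}(y) + f(e₁)G_{e₂}(x)H_{e₃}(y)
 − f(e₂)G_{e₁}(x)H_{e₂}(y) − f(e₂)G_{e₂}(x)H_{e₁}(y)]`. [this work] -/
def tpKernel (k : ℕ) (π : Fin k → ℕ) (f : Pt k → ℝ) (θ : Pt k → Pt k → Pt k → ℝ) (φ ψ ψ' : Pt k → ℝ) : ℝ :=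
  ∑ σ : Pt k × Pt k × Pt k, arrInd π σ.1 σ.2.1 σ.2.2 *
    ((2 * f σ.1 - θ σ.1 σ.2.1 σ.2.2) * (φ σ.1 * ψ σ.1) - f σ.1 * (φ σ.2.1 * ψ σ.2.1)
      + θ σ.1 σ.2.1 σ.2.2 * (φ σ.1 * ψ' σ.1) + f σ.1 * (φ σ.2.1 * ψ' σ.2.2)
      - f σ.2.1 * (φ σ.1 * ψ' σ.2.1) - f σ.2.1 * (φ σ.2.1 * ψ' σ.1))

/-- ★★ **THE TWO-POINT REDUCTION.**  Let `f` be any real function on the front cube `{0,1}^k` (the free slot), `π` a front profile, and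
`θ ≥ 0` a per-arrangement conversion weight such that the two finite inequalities (N1) and (N2) hold for ALL pairs of nonnegative monotone
level-functions `φ, ψ` on `{0,1}^k`:
(N1) `0 ≤ Σ_arr [(2f(e₁) − θ)φ(e₁)ψ(e₁) − f(e₁)φ(e₂)ψ(e₂)]`,
(N2) `0 ≤ Σ_arr [θ φ(e₁)ψ(e₁) + f(e₁)φ(e₂)ψ(e₃) − f(e₂)φ(e₁)ψ(e₂) − f(e₂)φ(e₂)ψ(e₁)]`.
Then for EVERY back profile `b` on a cube of ANY dimension `d` and ALL nonnegative monotone `G, H` on `{0,1}^{d+k}`: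
`0 ≤ c_{(π,b)}(frontFn f, G, H)` — 3C-SAHI for the free slot `f` against two ARBITRARY slots.  Proof: token form, three-copy Harris on the back cube
with the weights `θ`, and the pointwise kernel `K(x,y) = N1(G(x),H(x)) + N2(G(x),H(y)) ≥ 0`. [this work] -/
theorem tc_frontFn_nonneg_of_twoPoint (k : ℕ) (π : Fin k → ℕ) (f : Pt k → ℝ) (θ : Pt k → Pt k → Pt k → ℝ)
    (hθ : ∀ e₁ e₂ e₃, 0 ≤ θ e₁ e₂ e₃)
    (hN1 : ∀ φ ψ : Pt k → ℝ, (∀ e, 0 ≤ φ e) → (∀ e, 0 ≤ ψ e) → Monotone φ → Monotone ψ →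
      0 ≤ ∑ σ : Pt k × Pt k × Pt k, arrInd π σ.1 σ.2.1 σ.2.2 *
        ((2 * f σ.1 - θ σ.1 σ.2.1 σ.2.2) * (φ σ.1 * ψ σ.1) - f σ.1 * (φ σ.2.1 * ψ σ.2.1)))
    (hN2 : ∀ φ ψ : Pt k → ℝ, (∀ e, 0 ≤ φ e) → (∀ e, 0 ≤ ψ e) → Monotone φ → Monotone ψ →
      0 ≤ ∑ σ : Pt k × Pt k × Pt k, arrInd π σ.1 σ.2.1 σ.2.2 *
        (θ σ.1 σ.2.1 σ.2.2 * (φ σ.1 * ψ σ.1) + f σ.1 * (φ σ.2.1 * ψ σ.2.2)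
          - f σ.2.1 * (φ σ.1 * ψ σ.2.1) - f σ.2.1 * (φ σ.2.1 * ψ σ.1)))
    (b : Fin d → ℕ) {G H : Pt (d + k) → ℝ} (hG : ∀ w, 0 ≤ G w) (hH : ∀ w, 0 ≤ H w) (hGm : Monotone G) (hHm : Monotone H) :
    0 ≤ tc (appendProf k π b) (frontFn k f) G H := by
  -- notation for the sections
  set Gs : Pt k → Pt d → ℝ := fun e => secF k e G with hGs
  set Hs : Pt k → Pt d → ℝ := fun e => secF k e H with hHs
  have Gs0 : ∀ e y, 0 ≤ Gs e y := fun e y => secF_nonneg k e hG y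
  have Hs0 : ∀ e y, 0 ≤ Hs e y := fun e y => secF_nonneg k e hH y
  have Gsm : ∀ e, Monotone (Gs e) := fun e => secF_monotone k e hGm
  have Hsm : ∀ e, Monotone (Hs e) := fun e => secF_monotone k e hHm
  -- Step A: token form, then Harris on the diagonal terms with weight θ
  rw [tc_frontFn_eq, sum3_ite_eq_sum_triple]
  have harris : ∀ e, N3 b (Gs e) (Hs e) 1 ≤ N3 b (Gs e * Hs e) 1 1 :=
    fun e => N3_le_N3_mul d b (Gs e) (Hs e) 1 (Gs0 e) (Gsm e) (Hs0 e) (Hsm e) fun _ => zero_le_one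
  have stepA : ∀ σ : Pt k × Pt k × Pt k,
      arrInd π σ.1 σ.2.1 σ.2.2 * ((2 * f σ.1 - θ σ.1 σ.2.1 σ.2.2) * N3 b (Gs σ.1 * Hs σ.1) 1 1 - f σ.1 * N3 b (Gs σ.2.1 * Hs σ.2.1) 1 1
        + θ σ.1 σ.2.1 σ.2.2 * N3 b (Gs σ.1) (Hs σ.1) 1 + f σ.1 * N3 b (Gs σ.2.1) (Hs σ.2.2) 1
        - f σ.2.1 * N3 b (Gs σ.1) (Hs σ.2.1) 1 - f σ.2.1 * N3 b (Gs σ.2.1) (Hs σ.1) 1)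
      ≤ arrInd π σ.1 σ.2.1 σ.2.2 * (2 * f σ.1 * N3 b (secF k σ.1 G * secF k σ.1 H) 1 1 - f σ.1 * N3 b (secF k σ.2.1 G * secF k σ.2.1 H) 1 1
        - f σ.2.1 * N3 b (secF k σ.1 G) (secF k σ.2.1 H) 1 - f σ.2.1 * N3 b (secF k σ.1 H) (secF k σ.2.1 G) 1
        + f σ.1 * N3 b 1 (secF k σ.2.1 G) (secF k σ.2.2 H)) := by
    intro σ
    have e1 : N3 b (secF k σ.1 H) (secF k σ.2.1 G) 1 = N3 b (Gs σ.2.1) (Hs σ.1) 1 := N3_comm12 b _ _ _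
    have e2 : N3 b 1 (secF k σ.2.1 G) (secF k σ.2.2 H) = N3 b (Gs σ.2.1) (Hs σ.2.2) 1 := by
      rw [N3_comm12, N3_comm23]
    rw [e1, e2]
    have key := mul_le_mul_of_nonneg_left (harris σ.1) (hθ σ.1 σ.2.1 σ.2.2)
    have := arrInd_nonneg π σ.1 σ.2.1 σ.2.2
    apply mul_le_mul_of_nonneg_left _ this
    simp only [hGs, hHs] at key ⊢
    linarith
  refine le_trans ?_ (sum_le_sum fun σ _ => stepA σ)
  -- Step B: everything is a sum over back triples of the pointwise kernel
  have stepB : (∑ σ : Pt k × Pt k × Pt k,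
      arrInd π σ.1 σ.2.1 σ.2.2 * ((2 * f σ.1 - θ σ.1 σ.2.1 σ.2.2) * N3 b (Gs σ.1 * Hs σ.1) 1 1 - f σ.1 * N3 b (Gs σ.2.1 * Hs σ.2.1) 1 1
        + θ σ.1 σ.2.1 σ.2.2 * N3 b (Gs σ.1) (Hs σ.1) 1 + f σ.1 * N3 b (Gs σ.2.1) (Hs σ.2.2) 1
        - f σ.2.1 * N3 b (Gs σ.1) (Hs σ.2.1) 1 - f σ.2.1 * N3 b (Gs σ.2.1) (Hs σ.1) 1)) =
      ∑ τ : Pt d × Pt d × Pt d, arrInd b τ.1 τ.2.1 τ.2.2 *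
        tpKernel k π f θ (fun e => Gs e τ.1) (fun e => Hs e τ.1) (fun e => Hs e τ.2.1) := by
    simp only [N3_eq_sum_triple, tpKernel, Pi.mul_apply, Pi.one_apply, mul_one, mul_sum, ← sum_sub_distrib, ← sum_add_distrib]
    rw [sum_comm]
    refine sum_congr rfl fun τ _ => sum_congr rfl fun σ _ => ?_
    ring
  rw [stepB]
  -- Step C: the kernel is `N1 + N2 ≥ 0` pointwise
  refine sum_nonneg fun τ _ => mul_nonneg (arrInd_nonneg b _ _ _) ?_
  have lvl_mono_G : ∀ y, Monotone (fun e => Gs e y) := fun y e e' hee' => secF_mono_level k hee' hGm y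
  have lvl_mono_H : ∀ y, Monotone (fun e => Hs e y) := fun y e e' hee' => secF_mono_level k hee' hHm y
  have h1 := hN1 (fun e => Gs e τ.1) (fun e => Hs e τ.1) (fun e => Gs0 e _) (fun e => Hs0 e _) (lvl_mono_G _) (lvl_mono_H _)
  have h2 := hN2 (fun e => Gs e τ.1) (fun e => Hs e τ.2.1) (fun e => Gs0 e _) (fun e => Hs0 e _) (lvl_mono_G _) (lvl_mono_H _)
  have split : tpKernel k π f θ (fun e => Gs e τ.1) (fun e => Hs e τ.1) (fun e => Hs e τ.2.1) =
      (∑ σ : Pt k × Pt k × Pt k, arrInd π σ.1 σ.2.1 σ.2.2 *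
        ((2 * f σ.1 - θ σ.1 σ.2.1 σ.2.2) * (Gs σ.1 τ.1 * Hs σ.1 τ.1) - f σ.1 * (Gs σ.2.1 τ.1 * Hs σ.2.1 τ.1))) +
      (∑ σ : Pt k × Pt k × Pt k, arrInd π σ.1 σ.2.1 σ.2.2 *
        (θ σ.1 σ.2.1 σ.2.2 * (Gs σ.1 τ.1 * Hs σ.1 τ.2.1) + f σ.1 * (Gs σ.2.1 τ.1 * Hs σ.2.2 τ.2.1)
          - f σ.2.1 * (Gs σ.1 τ.1 * Hs σ.2.1 τ.2.1) - f σ.2.1 * (Gs σ.2.1 τ.1 * Hs σ.1 τ.2.1))) := by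
    unfold tpKernel
    rw [← sum_add_distrib]
    refine sum_congr rfl fun σ _ => ?_
    ring
  rw [split]
  exact add_nonneg h1 h2

/-! ### §5 From up-sets to level-functions (bilinearity + finite layer cake) -/

/-- A map `Q` on pairs of level-functions that is additive and homogeneous in each argument and nonnegative on all pairs of indicators of
up-sets is nonnegative on all pairs of nonnegative monotone functions (finite layer cake in each argument). [this work] -/
theorem bilin_nonneg_of_upperSets {k : ℕ} (Q : (Pt k → ℝ) → (Pt k → ℝ) → ℝ)
    (hadd₁ : ∀ φ φ' ψ, Q (φ + φ') ψ = Q φ ψ + Q φ' ψ) (hsmul₁ : ∀ (c : ℝ) φ ψ, Q (c • φ) ψ = c * Q φ ψ)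
    (hadd₂ : ∀ φ ψ ψ', Q φ (ψ + ψ') = Q φ ψ + Q φ ψ') (hsmul₂ : ∀ (c : ℝ) φ ψ, Q φ (c • ψ) = c * Q φ ψ)
    (hup : ∀ V W : Finset (Pt k), IsUpperSet (V : Set (Pt k)) → IsUpperSet (W : Set (Pt k)) → 0 ≤ Q (setInd V) (setInd W))
    {φ ψ : Pt k → ℝ} (hφ : ∀ e, 0 ≤ φ e) (hψ : ∀ e, 0 ≤ ψ e) (hφm : Monotone φ) (hψm : Monotone ψ) : 0 ≤ Q φ ψ := by
  classical
  have zero₁ : ∀ ψ, Q 0 ψ = 0 := fun ψ => by simpa using hsmul₁ 0 0 ψ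
  have zero₂ : ∀ φ, Q φ 0 = 0 := fun φ => by simpa using hsmul₂ 0 φ 0
  -- inner: indicators of up-sets against good lists
  have inner : ∀ (V : Finset (Pt k)), IsUpperSet (V : Set (Pt k)) →
      ∀ l : List (ℝ × Finset (Pt k)), (∀ p ∈ l, 0 ≤ p.1 ∧ IsUpperSet ((p.2 : Finset (Pt k)) : Set (Pt k))) →
        0 ≤ Q (setInd V) (l.map fun p => p.1 • setInd p.2).sum := by
    intro V hV l hl
    induction l with
    | nil => simp [zero₂]
    | cons p l ih =>
      rw [List.map_cons, List.sum_cons, hadd₂, hsmul₂]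
      have hp := hl p (by simp)
      exact add_nonneg (mul_nonneg hp.1 (hup V p.2 hV hp.2)) (ih fun q hq => hl q (by simp [hq]))
  obtain ⟨lψ, hlψ, hψeq⟩ := exists_upperSet_decomposition ψ hψ hψm
  obtain ⟨lφ, hlφ, hφeq⟩ := exists_upperSet_decomposition φ hφ hφm
  rw [hφeq, hψeq]
  clear hφeq hψeq
  induction lφ with
  | nil => simp [zero₁]
  | cons p l ih =>
    rw [List.map_cons, List.sum_cons, hadd₁, hsmul₁]
    have hp := hlφ p (by simp)
    exact add_nonneg (mul_nonneg hp.1 (inner p.2 hp.2 lψ hlψ)) (ih fun q hq => hlφ q (by simp [hq]))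

/-- The form (N1) as a map of two level-functions. [this work] -/
def N1form (k : ℕ) (π : Fin k → ℕ) (f : Pt k → ℝ) (θ : Pt k → Pt k → Pt k → ℝ) (φ ψ : Pt k → ℝ) : ℝ :=
  ∑ σ : Pt k × Pt k × Pt k, arrInd π σ.1 σ.2.1 σ.2.2 *
    ((2 * f σ.1 - θ σ.1 σ.2.1 σ.2.2) * (φ σ.1 * ψ σ.1) - f σ.1 * (φ σ.2.1 * ψ σ.2.1))

/-- The form (N2) as a map of two level-functions. [this work] -/
def N2form (k : ℕ) (π : Fin k → ℕ) (f : Pt k → ℝ) (θ : Pt k → Pt k → Pt k → ℝ) (φ ψ : Pt k → ℝ) : ℝ :=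
  ∑ σ : Pt k × Pt k × Pt k, arrInd π σ.1 σ.2.1 σ.2.2 *
    (θ σ.1 σ.2.1 σ.2.2 * (φ σ.1 * ψ σ.1) + f σ.1 * (φ σ.2.1 * ψ σ.2.2)
      - f σ.2.1 * (φ σ.1 * ψ σ.2.1) - f σ.2.1 * (φ σ.2.1 * ψ σ.1))

/-- (N1) is additive in the first argument. [this work] -/
theorem N1form_add₁ (k : ℕ) (π : Fin k → ℕ) (f : Pt k → ℝ) (θ : Pt k → Pt k → Pt k → ℝ) (φ φ' ψ : Pt k → ℝ) :
    N1form k π f θ (φ + φ') ψ = N1form k π f θ φ ψ + N1form k π f θ φ' ψ := by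
  unfold N1form; rw [← sum_add_distrib]; exact sum_congr rfl fun σ _ => by simp only [Pi.add_apply]; ring
/-- (N1) is homogeneous in the first argument. [this work] -/
theorem N1form_smul₁ (k : ℕ) (π : Fin k → ℕ) (f : Pt k → ℝ) (θ : Pt k → Pt k → Pt k → ℝ) (c : ℝ) (φ ψ : Pt k → ℝ) :
    N1form k π f θ (c • φ) ψ = c * N1form k π f θ φ ψ := by
  unfold N1form; rw [mul_sum]; exact sum_congr rfl fun σ _ => by simp only [Pi.smul_apply, smul_eq_mul]; ring
/-- (N1) is additive in the second argument. [this work] -/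
theorem N1form_add₂ (k : ℕ) (π : Fin k → ℕ) (f : Pt k → ℝ) (θ : Pt k → Pt k → Pt k → ℝ) (φ ψ ψ' : Pt k → ℝ) :
    N1form k π f θ φ (ψ + ψ') = N1form k π f θ φ ψ + N1form k π f θ φ ψ' := by
  unfold N1form; rw [← sum_add_distrib]; exact sum_congr rfl fun σ _ => by simp only [Pi.add_apply]; ring
/-- (N1) is homogeneous in the second argument. [this work] -/
theorem N1form_smul₂ (k : ℕ) (π : Fin k → ℕ) (f : Pt k → ℝ) (θ : Pt k → Pt k → Pt k → ℝ) (c : ℝ) (φ ψ : Pt k → ℝ) :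
    N1form k π f θ φ (c • ψ) = c * N1form k π f θ φ ψ := by
  unfold N1form; rw [mul_sum]; exact sum_congr rfl fun σ _ => by simp only [Pi.smul_apply, smul_eq_mul]; ring
/-- (N2) is additive in the first argument. [this work] -/
theorem N2form_add₁ (k : ℕ) (π : Fin k → ℕ) (f : Pt k → ℝ) (θ : Pt k → Pt k → Pt k → ℝ) (φ φ' ψ : Pt k → ℝ) :
    N2form k π f θ (φ + φ') ψ = N2form k π f θ φ ψ + N2form k π f θ φ' ψ := by
  unfold N2form; rw [← sum_add_distrib]; exact sum_congr rfl fun σ _ => by simp only [Pi.add_apply]; ring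
/-- (N2) is homogeneous in the first argument. [this work] -/
theorem N2form_smul₁ (k : ℕ) (π : Fin k → ℕ) (f : Pt k → ℝ) (θ : Pt k → Pt k → Pt k → ℝ) (c : ℝ) (φ ψ : Pt k → ℝ) :
    N2form k π f θ (c • φ) ψ = c * N2form k π f θ φ ψ := by
  unfold N2form; rw [mul_sum]; exact sum_congr rfl fun σ _ => by simp only [Pi.smul_apply, smul_eq_mul]; ring
/-- (N2) is additive in the second argument. [this work] -/
theorem N2form_add₂ (k : ℕ) (π : Fin k → ℕ) (f : Pt k → ℝ) (θ : Pt k → Pt k → Pt k → ℝ) (φ ψ ψ' : Pt k → ℝ) :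
    N2form k π f θ φ (ψ + ψ') = N2form k π f θ φ ψ + N2form k π f θ φ ψ' := by
  unfold N2form; rw [← sum_add_distrib]; exact sum_congr rfl fun σ _ => by simp only [Pi.add_apply]; ring
/-- (N2) is homogeneous in the second argument. [this work] -/
theorem N2form_smul₂ (k : ℕ) (π : Fin k → ℕ) (f : Pt k → ℝ) (θ : Pt k → Pt k → Pt k → ℝ) (c : ℝ) (φ ψ : Pt k → ℝ) :
    N2form k π f θ φ (c • ψ) = c * N2form k π f θ φ ψ := by
  unfold N2form; rw [mul_sum]; exact sum_congr rfl fun σ _ => by simp only [Pi.smul_apply, smul_eq_mul]; ring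

/-- ★★ **THE TWO-POINT REDUCTION, up-set form (the SANDWICH certificate).**  If the forms (N1), (N2) are nonnegative on all pairs of
indicators of UP-SETS `V, W ⊆ {0,1}^k` — i.e. `0 ≤ s(V∩W)` and `s(V∩W) ≤ c_π(1_f,1_V,1_W)` in the notation of memo gen59 §2 — then
`c_{(π,b)}(frontFn f, G, H) ≥ 0` for every back profile in every dimension and all nonnegative monotone `G, H`. [this work] -/
theorem tc_frontFn_nonneg_of_upSets (k : ℕ) (π : Fin k → ℕ) (f : Pt k → ℝ) (θ : Pt k → Pt k → Pt k → ℝ)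
    (hθ : ∀ e₁ e₂ e₃, 0 ≤ θ e₁ e₂ e₃)
    (hS1 : ∀ V W : Finset (Pt k), IsUpperSet (V : Set (Pt k)) → IsUpperSet (W : Set (Pt k)) → 0 ≤ N1form k π f θ (setInd V) (setInd W))
    (hS2 : ∀ V W : Finset (Pt k), IsUpperSet (V : Set (Pt k)) → IsUpperSet (W : Set (Pt k)) → 0 ≤ N2form k π f θ (setInd V) (setInd W))
    (b : Fin d → ℕ) {G H : Pt (d + k) → ℝ} (hG : ∀ w, 0 ≤ G w) (hH : ∀ w, 0 ≤ H w) (hGm : Monotone G) (hHm : Monotone H) :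
    0 ≤ tc (appendProf k π b) (frontFn k f) G H :=
  tc_frontFn_nonneg_of_twoPoint k π f θ hθ
    (fun _ _ hφ hψ hφm hψm => bilin_nonneg_of_upperSets (N1form k π f θ) (N1form_add₁ k π f θ) (N1form_smul₁ k π f θ)
      (N1form_add₂ k π f θ) (N1form_smul₂ k π f θ) hS1 hφ hψ hφm hψm)
    (fun _ _ hφ hψ hφm hψm => bilin_nonneg_of_upperSets (N2form k π f θ) (N2form_add₁ k π f θ) (N2form_smul₁ k π f θ)
      (N2form_add₂ k π f θ) (N2form_smul₂ k π f θ) hS2 hφ hψ hφm hψm)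
    b hG hH hGm hHm

end

end Summit.CriticalPhenomena.PercolationContinuityZ3.Theorems.SahiThreeCopy
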